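import Summits.ResolutionOfSingularities.ResolutionOfSingularities.Theorems.FrobeniusLadderFInjectiveMacaulayficationExceptionalSlices
import Summits.ResolutionOfSingularities.ResolutionOfSingularities.Theorems.FrobeniusLadderFInjectiveMacaulayficationFiClauseOfRegular
import Mathlib.Algebra.CharP.Algebra
import Mathlib.RingTheory.RegularLocalRing.Defs
import HarnessLib

/-!
# R1 corollary «REGULAR exceptional slices ⇒ PFix» (crux `FInjectiveMacaulayfication`, line T-F under #4β)

Support file for crux stmt-ResolutionOfSingularities-15315 (`FrobeniusLadder.FInjectiveMacaulayfication`), chain w45a.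
[OURS · L1 W4.5a] — NOT a statement of any manuscript [claim: Hironaka2017]; AI-written, weaker than expert review; no statement of
the manuscript is used.  Ruling R14.4 (1) of res-L1-w45a-plan-1 (statement-owner answer res-L1-w45a-strat-1 2026-08-27T17:06:51Z (A):
«cite the tree, no new signatures»); filer res-L1-w45a-stub-4.

The tree theorem `ExceptionalSlices.pfixData_of_exceptionalSlices_holds` (R1 UNCONDITIONAL, chart form) says: for a Noetherian local
domain `(A, 𝔪)` of characteristic `p` and nonzero generators `c` of an `𝔪`-primary ideal, if every EXCEPTIONAL SLICE — the localised
chart ring `A[(c)/c_j]_𝔔` (`𝔔` over `𝔪`, any presentation `L`) modulo the local equation `c_j` of the exceptional divisor — satisfies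
the CM clause and the F-clause of the crux, then `(c)` is a PFix-centre (`PFixData p A`: one blow-up, every stalk over `b` a domain
with weakly regular systems of parameters generating Frobenius-closed ideals).

This file records the sub-case the coming INSTANCES use (res-L1-w45a-lead-1's cone family, R14.4 (2): affine cones over smooth
projective hypersurfaces, where the exceptional slices are the dehomogenised smooth affine hypersurfaces): **if every exceptional slice
is a REGULAR local ring, then `PFixData p A`.**  A regular local ring of characteristic `p` satisfies both clauses —
`FiClauseOfRegular.stub_fiClauseOfRegular` (Matsumura 14.3 / 17.4 + Kunz: domain, systems of parameters are regular sequences, every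
ideal Frobenius closed) — and the characteristic passes to the slice by `CharP.of_ringHom_of_ne_zero` (the slice is local, hence
nontrivial).  Two forms: `pfixData_of_regularExceptionalSlices_holds` (hypothesis over every presentation `L`, the shape of the tree
theorem) and the single-presentation convenience form `pfixData_of_regularExceptionalSlices_holds'` (regularity of
`L₀ ⧸ (c_j)` for SOME presentation `L₀` per point; transported to every presentation by `IsLocalization.algEquiv` +
`Ideal.quotientEquivAlg` + `IsRegularLocalRing.of_ringEquiv`).
[OURS · kernel glue sorry-free; mathematics = Fedder's deformation (tree theorem `Deformation.cmfi_of_cmfi_quotient`) + Kunz]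
-/

-- single-problem summit: the doubled namespace component is forced
set_option linter.dupNamespace false

noncomputable section

open Literature.AlgebraicGeometry.Resolution IsLocalRing

namespace Summit.ResolutionOfSingularities.ResolutionOfSingularities.Theorems.FInjectiveMacaulayfication.RegularExceptionalSlices

/-- **Regular local ring of characteristic `p` ⇒ CM clause ∧ F-clause** (split form of `FiClauseOfRegular.stub_fiClauseOfRegular`,
with `p.Prime →` instead of `[Fact p.Prime]`). [cite: Matsumura1987, Thm. 14.3 and Thm. 17.4] -/
theorem cmClause_and_fClause_of_isRegularLocalRing {p : ℕ} (hp : p.Prime) (O : Type) [CommRing O] [IsRegularLocalRing O]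
    [CharP O p] :
    (∀ d : ℕ, ringKrullDim O = d → ∀ s : Fin d → O, (Ideal.span (Set.range s)).radical.IsMaximal →
        RingTheory.Sequence.IsWeaklyRegular O (List.ofFn s)) ∧
      (∀ d : ℕ, ringKrullDim O = d → ∀ s : Fin d → O, (Ideal.span (Set.range s)).radical.IsMaximal →
        ∀ y : O, (∃ e : ℕ, y ^ p ^ e ∈ Ideal.span ((fun z : O => z ^ p ^ e) '' (Ideal.span (Set.range s) : Set O))) →
          y ∈ Ideal.span (Set.range s)) := by
  haveI : Fact p.Prime := ⟨hp⟩
  obtain ⟨-, h⟩ := FiClauseOfRegular.stub_fiClauseOfRegular p O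
  exact ⟨fun d hd s hs => (h d hd s hs).1, fun d hd s hs => (h d hd s hs).2⟩

/-- **R1 corollary (chart form, every presentation): REGULAR exceptional slices ⇒ `(c)` is a PFix-centre.**  For a Noetherian local
domain `(A, 𝔪)` of prime characteristic `p` and nonzero generators `c` of an `𝔪`-primary ideal: if at every prime `𝔔` of every chart
`A[(c)/c_j]` lying over `𝔪`, for every presentation `L` of the localisation at `𝔔`, the slice `L ⧸ (c_j)` is a regular local ring, then
`PFixData p A` (conclusion verbatim = `ExceptionalSlices.pfixData_of_exceptionalSlices_holds`).  Proof: the slice inherits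
characteristic `p` (`CharP.of_ringHom_of_ne_zero` along `A → A[(c)/c_j] → L → L ⧸ (c_j)`, the target being local hence nontrivial) and a
regular local ring of characteristic `p` satisfies both clauses (`cmClause_and_fClause_of_isRegularLocalRing`); feed
`pfixData_of_exceptionalSlices_holds`. [OURS assembly over the tree] [cite: Fedder1983, Thm. 3.4 (1)] [cite: Matsumura1987, Thm. 17.4] -/
theorem pfixData_of_regularExceptionalSlices_holds {p : ℕ} (hp : p.Prime)
    {A : Type} [CommRing A] [IsDomain A] [IsNoetherianRing A] [IsLocalRing A] [CharP A p]
    {n : ℕ} (c : Fin n → A) (hc0 : ∀ j, c j ≠ 0) (hne : Ideal.span (Set.range c) ≠ ⊥)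
    (hrad : (Ideal.span (Set.range c)).radical = maximalIdeal A)
    (hReg : ∀ (j : Fin n) (𝔔 : PrimeSpectrum (blowupAlgebra (Ideal.span (Set.range c)) (c j))),
      𝔔.asIdeal.comap (algebraMap A (blowupAlgebra (Ideal.span (Set.range c)) (c j))) = maximalIdeal A →
        ∀ (L : Type) [CommRing L] [Algebra (blowupAlgebra (Ideal.span (Set.range c)) (c j)) L]
          [IsLocalization.AtPrime L 𝔔.asIdeal],
        IsRegularLocalRing (L ⧸ Ideal.span {algebraMap (blowupAlgebra (Ideal.span (Set.range c)) (c j)) L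
          (algebraMap A (blowupAlgebra (Ideal.span (Set.range c)) (c j)) (c j))})) :
    ∃ (n : ℕ) (c : Fin n → A), Ideal.span (Set.range c) ≠ ⊥ ∧ (Ideal.span (Set.range c)).radical = maximalIdeal A ∧
      ∀ (j : Fin n) (𝔔 : PrimeSpectrum (blowupAlgebra (Ideal.span (Set.range c)) (c j))),
        𝔔.asIdeal.comap (algebraMap A (blowupAlgebra (Ideal.span (Set.range c)) (c j))) = maximalIdeal A →
        (IsDomain (Localization.AtPrime 𝔔.asIdeal) ∧ ∀ d : ℕ, ringKrullDim (Localization.AtPrime 𝔔.asIdeal) = d → ∀ s : Fin d → (Localization.AtPrime 𝔔.asIdeal), (Ideal.span (Set.range s)).radical.IsMaximal →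
          RingTheory.Sequence.IsWeaklyRegular (Localization.AtPrime 𝔔.asIdeal) (List.ofFn s) ∧
          ∀ y : (Localization.AtPrime 𝔔.asIdeal), (∃ e : ℕ, y ^ p ^ e ∈ Ideal.span ((fun z : (Localization.AtPrime 𝔔.asIdeal) => z ^ p ^ e) '' (Ideal.span (Set.range s) : Set (Localization.AtPrime 𝔔.asIdeal)))) →
            y ∈ Ideal.span (Set.range s)) := by
  refine ExceptionalSlices.pfixData_of_exceptionalSlices_holds hp c hc0 hne hrad fun j 𝔔 h𝔔 L _ _ _ => ?_
  haveI hR := hReg j 𝔔 h𝔔 L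
  -- the slice inherits characteristic `p` from the domain `A`
  haveI : CharP (L ⧸ Ideal.span {algebraMap (blowupAlgebra (Ideal.span (Set.range c)) (c j)) L
      (algebraMap A (blowupAlgebra (Ideal.span (Set.range c)) (c j)) (c j))}) p :=
    CharP.of_ringHom_of_ne_zero
      ((Ideal.Quotient.mk _).comp (((algebraMap (blowupAlgebra (Ideal.span (Set.range c)) (c j)) L)).comp
        (algebraMap A (blowupAlgebra (Ideal.span (Set.range c)) (c j))))) p hp.ne_zero
  exact cmClause_and_fClause_of_isRegularLocalRing hp _

/-- Transport of the slice between two presentations of the same localisation: for `L₁`, `L₂` localisations of `B` at the prime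
`𝔔`, `L₁ ⧸ (b) ≃+* L₂ ⧸ (b)` for every `b : B` (`IsLocalization.algEquiv` + `Ideal.quotientEquivAlg`; stated as `Nonempty` so the file stays definition-free).  (The standard presentation
`Localization.AtPrime 𝔔.asIdeal ⧸ (b)` is deliberately not singled out: for `𝔔` a prime of the blow-up algebra — a subalgebra of
`Localization.Away (c j)` — the `HasQuotient` instance on it does not synthesise (nested `OreLocalization` semiring diamond), which
is why the tree theorem quantifies over presentations.) [folklore] -/
theorem nonempty_sliceEquiv {B : Type} [CommRing B] (𝔔 : Ideal B) [𝔔.IsPrime] (L₁ L₂ : Type) [CommRing L₁] [Algebra B L₁]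
    [IsLocalization.AtPrime L₁ 𝔔] [CommRing L₂] [Algebra B L₂] [IsLocalization.AtPrime L₂ 𝔔] (b : B) :
    Nonempty ((L₁ ⧸ Ideal.span {algebraMap B L₁ b}) ≃+* (L₂ ⧸ Ideal.span {algebraMap B L₂ b})) :=
  ⟨(Ideal.quotientEquivAlg (Ideal.span {algebraMap B L₁ b}) (Ideal.span {algebraMap B L₂ b})
    (IsLocalization.algEquiv 𝔔.primeCompl L₁ L₂) (by
      rw [Ideal.map_span, Set.image_singleton, RingHom.coe_coe, AlgEquiv.commutes])).toRingEquiv⟩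

/-- **R1 corollary (chart form, one presentation per point): REGULAR exceptional slices ⇒ `(c)` is a PFix-centre.**  As
`pfixData_of_regularExceptionalSlices_holds`, with the regularity hypothesis asked for SOME presentation `L₀` of the localisation at
each `𝔔` over `𝔪` (the instance's favourite chart model); every other presentation `L` is reached through `nonempty_sliceEquiv` and
`IsRegularLocalRing.of_ringEquiv`.  This is the form instances discharge chart by chart. [OURS assembly over the tree]
[cite: Fedder1983, Thm. 3.4 (1)] -/
theorem pfixData_of_regularExceptionalSlices_holds' {p : ℕ} (hp : p.Prime)
    {A : Type} [CommRing A] [IsDomain A] [IsNoetherianRing A] [IsLocalRing A] [CharP A p]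
    {n : ℕ} (c : Fin n → A) (hc0 : ∀ j, c j ≠ 0) (hne : Ideal.span (Set.range c) ≠ ⊥)
    (hrad : (Ideal.span (Set.range c)).radical = maximalIdeal A)
    (hReg : ∀ (j : Fin n) (𝔔 : PrimeSpectrum (blowupAlgebra (Ideal.span (Set.range c)) (c j))),
      𝔔.asIdeal.comap (algebraMap A (blowupAlgebra (Ideal.span (Set.range c)) (c j))) = maximalIdeal A →
        ∃ (L₀ : Type) (_ : CommRing L₀) (_ : Algebra (blowupAlgebra (Ideal.span (Set.range c)) (c j)) L₀)
          (_ : IsLocalization.AtPrime L₀ 𝔔.asIdeal),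
        IsRegularLocalRing (L₀ ⧸ Ideal.span {algebraMap (blowupAlgebra (Ideal.span (Set.range c)) (c j)) L₀
          (algebraMap A (blowupAlgebra (Ideal.span (Set.range c)) (c j)) (c j))})) :
    ∃ (n : ℕ) (c : Fin n → A), Ideal.span (Set.range c) ≠ ⊥ ∧ (Ideal.span (Set.range c)).radical = maximalIdeal A ∧
      ∀ (j : Fin n) (𝔔 : PrimeSpectrum (blowupAlgebra (Ideal.span (Set.range c)) (c j))),
        𝔔.asIdeal.comap (algebraMap A (blowupAlgebra (Ideal.span (Set.range c)) (c j))) = maximalIdeal A →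
        (IsDomain (Localization.AtPrime 𝔔.asIdeal) ∧ ∀ d : ℕ, ringKrullDim (Localization.AtPrime 𝔔.asIdeal) = d → ∀ s : Fin d → (Localization.AtPrime 𝔔.asIdeal), (Ideal.span (Set.range s)).radical.IsMaximal →
          RingTheory.Sequence.IsWeaklyRegular (Localization.AtPrime 𝔔.asIdeal) (List.ofFn s) ∧
          ∀ y : (Localization.AtPrime 𝔔.asIdeal), (∃ e : ℕ, y ^ p ^ e ∈ Ideal.span ((fun z : (Localization.AtPrime 𝔔.asIdeal) => z ^ p ^ e) '' (Ideal.span (Set.range s) : Set (Localization.AtPrime 𝔔.asIdeal)))) →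
            y ∈ Ideal.span (Set.range s)) := by
  refine pfixData_of_regularExceptionalSlices_holds hp c hc0 hne hrad fun j 𝔔 h𝔔 L _ _ _ => ?_
  obtain ⟨L₀, _, _, _, hR⟩ := hReg j 𝔔 h𝔔
  haveI := hR
  obtain ⟨e⟩ := nonempty_sliceEquiv 𝔔.asIdeal L₀ L
    (algebraMap A (blowupAlgebra (Ideal.span (Set.range c)) (c j)) (c j))
  exact IsRegularLocalRing.of_ringEquiv (e := e)

end Summit.ResolutionOfSingularities.ResolutionOfSingularities.Theorems.FInjectiveMacaulayfication.RegularExceptionalSlices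

end
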